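import Summits.CriticalPhenomena.PercolationContinuityZ3.Theorems.PercNearOneGluingNoHeavyLowerTailNineTypeTwins
import Summits.CriticalPhenomena.PercolationContinuityZ3.Theorems.PercNearOneGluingNoHeavyLowerTailNineTypeRectangle

/-!
# Nine-type programme for `Q44b`: the general RECTANGLE LEMMA (free or type-6 lower corner)

Support file for crux `stmt-CriticalPhenomena-4575` (master-family programme, quadratic four-point row `Q44b`,
GF(2)-rank line), seat `prim-bnk-1` gen 18; memo `run/shared/lean/prim/prim-l12/FROM-prim-bnk-1-gen18-KLEITMAN-SPLIT.md` §8–§10.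

`…NineTypeRectangle` treated the rectangle circuits `{f, f+i, a, a+i}` whose lower corner `f` is free (type `5/7`), using
the HH-good `q ∪ f`.  Here the lower corner `f ∈ 𝒯` may have ANY type `≤ 7` (in the data: type `6 ⊂ 5`, class `(1,2,1)` of
the memo, 11 % of all H-circuit tops at m=5), at the price of using the upper anchor `a' = insert i a ∈ 𝒯` instead:
* `rectangle_core_symm`: twins among the goods avoiding `i` also have `a \ f` in every such good;
* `rectangle'_no_inner_point`: no point avoiding `i` contains `(f ∪ a ∪ {i})ᶜ` — a type-`≤ 7` point `q` gives the good
  `q ∪ tᶜ ∌ i ⊇ f \ a`, whence `(a')ᶜ ⊆ q` (COV); a type-`8/9` point gives the good `q ∪ (a')ᶜ ∌ i ⊇ a \ f`, whence `tᶜ ⊆ q` (COV);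
* `rectangle'_bottom_good`: if some point `b` contains `(f ∪ a ∪ {i})ᶜ` (necessarily `b ∋ i`), then `f ∪ a` is a good
  (it contains the HL-good `a ∪ bᶜ` or `f ∪ bᶜ`);
* **`rectangle'_L_row_not_H_combination`**: hence the L-row of the top `t = insert i f` is not a GF(2)-combination of
  H-rows — by the filter certificate `x^{t ∪ a'}` when no point contains `(f ∪ a ∪ {i})ᶜ`, and by the interval certificate
  `[f ∪ a, {i}ᶜ]` otherwise.
Together with twins, forks and dual forks this settles 73 % of the H-circuit tops of the INT census at m=5 (memo §10).

Pure finite combinatorics; theorems only, no named facts, no sorries, standard axioms.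
-/

namespace Summit.CriticalPhenomena.PercolationContinuityZ3.Theorems

namespace NineType

open Finset

/-- Table fact: types `8, 9` are mutually HL-compatible. -/
theorem table_hl_89 : ∀ a : ℕ, (a = 8 ∨ a = 9) → ∀ b : ℕ, (b = 8 ∨ b = 9) → hlOK a b = true := by
  intro a ha b hb
  rcases ha with rfl | rfl <;> rcases hb with rfl | rfl <;> decide

/-- Table fact: types `8, 9` are HL-compatible with every non-free type, and every type `≤ 7` is HL-compatible with the
free types. -/
theorem table_hl_89_nonfree : ∀ a : ℕ, (a = 8 ∨ a = 9) → ∀ b : ℕ, 1 ≤ b → b ≤ 9 → ¬ (b = 5 ∨ b = 7) → hlOK a b = true := by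
  intro a ha b hb1 hb9 hb
  rcases ha with rfl | rfl <;> interval_cases b <;> simp_all <;> decide

variable {α : Type*} [DecidableEq α] [Fintype α]

omit [Fintype α] in
/-- Twins among the goods avoiding `i` have `a \ f` in every such good (companion of `rectangle_core`). [this work] -/
theorem rectangle_core_symm (𝔊 : Finset (Finset α))
    (hG : ∀ g ∈ 𝔊, ∀ g' : Finset α, g ⊆ g' → g' ∈ 𝔊)
    (f a : Finset α) (i : α) (hif : i ∉ f)
    (htwin : ∀ g ∈ 𝔊, i ∉ g → (f ⊆ g ↔ a ⊆ g)) :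
    ∀ g ∈ 𝔊, i ∉ g → a \ f ⊆ g :=
  rectangle_core 𝔊 hG a f i hif (fun g hg hig => (htwin g hg hig).symm)

/-- **No point avoiding `i` contains the complement of a rectangle** (general lower corner).  `f ∈ 𝒯` of any type `≤ 7`,
`t = insert i f ∈ 𝒯` free, `i ∉ f ∪ a`, `a' = insert i a ∈ 𝒯` of type `8/9`, and `f ⊆ g ↔ a ⊆ g` for every good `g ∌ i`.
Then no `q ∈ 𝒯` with `i ∉ q` contains `(f ∪ a ∪ {i})ᶜ`. [this work, memo §10] -/
theorem rectangle'_no_inner_point (𝒯 : Finset (Finset α)) (θ : Finset α → ℕ)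
    (hθ : ∀ s ∈ 𝒯, 1 ≤ θ s ∧ θ s ≤ 9)
    (hcov : ∀ s ∈ 𝒯, ∀ s' ∈ 𝒯, s ≠ s' → s ∪ s' ≠ univ)
    (𝔊 : Finset (Finset α)) (hG : ∀ g ∈ 𝔊, ∀ g' : Finset α, g ⊆ g' → g' ∈ 𝔊)
    (hHL : ∀ s ∈ 𝒯, ∀ s' ∈ 𝒯, hlOK (θ s) (θ s') = true → s ∪ s'ᶜ ∈ 𝔊)
    (f : Finset α) (i : α) (hif : i ∉ f)
    (t : Finset α) (ht : t ∈ 𝒯) (htf : t = insert i f) (ht57 : θ t = 5 ∨ θ t = 7)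
    (a : Finset α) (hia : i ∉ a)
    (a' : Finset α) (ha' : a' ∈ 𝒯) (ha'a : a' = insert i a) (ha'89 : θ a' = 8 ∨ θ a' = 9)
    (htwin : ∀ g ∈ 𝔊, i ∉ g → (f ⊆ g ↔ a ⊆ g)) :
    ∀ q ∈ 𝒯, i ∉ q → ¬ (f ∪ a ∪ {i})ᶜ ⊆ q := by
  intro q hq hiq hK
  have hqt : q ≠ t := fun h => hiq (by rw [h, htf]; exact Finset.mem_insert_self i f)
  have hqa' : q ≠ a' := fun h => hiq (by rw [h, ha'a]; exact Finset.mem_insert_self i a)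
  have hout : ∀ x, x ∉ f → x ∉ a → x ≠ i → x ∈ q := by
    intro x hxf hxa hxi
    apply hK
    rw [Finset.mem_compl, Finset.mem_union, Finset.mem_union, Finset.mem_singleton]
    rintro ((h | h) | h)
    · exact hxf h
    · exact hxa h
    · exact hxi h
  by_cases hq89 : θ q = 8 ∨ θ q = 9
  · -- the good `q ∪ a'ᶜ` avoids `i` and contains `a \ f`
    have hgood : q ∪ a'ᶜ ∈ 𝔊 := hHL q hq a' ha' (table_hl_89 (θ q) hq89 (θ a') ha'89)
    have higood : i ∉ q ∪ a'ᶜ := fun h => by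
      rcases Finset.mem_union.1 h with h | h
      · exact hiq h
      · exact (Finset.mem_compl.1 h) (by rw [ha'a]; exact Finset.mem_insert_self i a)
    have hcore : a \ f ⊆ q ∪ a'ᶜ := rectangle_core_symm 𝔊 hG f a i hif htwin _ hgood higood
    have haf : ∀ x, x ∈ a → x ∉ f → x ∈ q := by
      intro x hxa hxf
      rcases Finset.mem_union.1 (hcore (Finset.mem_sdiff.2 ⟨hxa, hxf⟩)) with h | h
      · exact h
      · exact absurd (by rw [ha'a]; exact Finset.mem_insert_of_mem hxa) (Finset.mem_compl.1 h)
    apply hcov q hq t ht hqt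
    refine Finset.eq_univ_iff_forall.2 fun x => ?_
    by_cases hxt : x ∈ t
    · exact Finset.mem_union.2 (Or.inr hxt)
    · have hxi : x ≠ i := fun h => hxt (by rw [htf, h]; exact Finset.mem_insert_self i f)
      have hxf : x ∉ f := fun h => hxt (by rw [htf]; exact Finset.mem_insert_of_mem h)
      refine Finset.mem_union.2 (Or.inl ?_)
      by_cases hxa : x ∈ a
      · exact haf x hxa hxf
      · exact hout x hxf hxa hxi
  · -- `q` has type `≤ 7`: the good `q ∪ tᶜ` avoids `i` and contains `f \ a`
    have hq7 : θ q ≤ 7 := by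
      rcases hθ q hq with ⟨_, h9⟩
      omega
    have hgood : q ∪ tᶜ ∈ 𝔊 := hHL q hq t ht (table_hl_low_free (θ q) (hθ q hq).1 hq7 (θ t) ht57)
    have higood : i ∉ q ∪ tᶜ := fun h => by
      rcases Finset.mem_union.1 h with h | h
      · exact hiq h
      · exact (Finset.mem_compl.1 h) (by rw [htf]; exact Finset.mem_insert_self i f)
    have hcore : f \ a ⊆ q ∪ tᶜ := rectangle_core 𝔊 hG f a i hia htwin _ hgood higood
    have hfa : ∀ x, x ∈ f → x ∉ a → x ∈ q := by
      intro x hxf hxa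
      rcases Finset.mem_union.1 (hcore (Finset.mem_sdiff.2 ⟨hxf, hxa⟩)) with h | h
      · exact h
      · exact absurd (by rw [htf]; exact Finset.mem_insert_of_mem hxf) (Finset.mem_compl.1 h)
    apply hcov q hq a' ha' hqa'
    refine Finset.eq_univ_iff_forall.2 fun x => ?_
    by_cases hxa' : x ∈ a'
    · exact Finset.mem_union.2 (Or.inr hxa')
    · have hxi : x ≠ i := fun h => hxa' (by rw [ha'a, h]; exact Finset.mem_insert_self i a)
      have hxa : x ∉ a := fun h => hxa' (by rw [ha'a]; exact Finset.mem_insert_of_mem h)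
      refine Finset.mem_union.2 (Or.inl ?_)
      by_cases hxf : x ∈ f
      · exact hfa x hxf hxa
      · exact hout x hxf hxa hxi

/-- If some point `b ∈ 𝒯` contains `(f ∪ a ∪ {i})ᶜ`, then the bottom `f ∪ a` of the rectangle is a good: `b ∋ i` by
`rectangle'_no_inner_point`, so `bᶜ ⊆ f ∪ a`, and `f ∪ a` contains the HL-good `a ∪ bᶜ` (if `b` is not free) or
`f ∪ bᶜ` (if `b` is free). [this work, memo §10] -/
theorem rectangle'_bottom_good (𝒯 : Finset (Finset α)) (θ : Finset α → ℕ)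
    (hθ : ∀ s ∈ 𝒯, 1 ≤ θ s ∧ θ s ≤ 9)
    (hcov : ∀ s ∈ 𝒯, ∀ s' ∈ 𝒯, s ≠ s' → s ∪ s' ≠ univ)
    (𝔊 : Finset (Finset α)) (hG : ∀ g ∈ 𝔊, ∀ g' : Finset α, g ⊆ g' → g' ∈ 𝔊)
    (hHL : ∀ s ∈ 𝒯, ∀ s' ∈ 𝒯, hlOK (θ s) (θ s') = true → s ∪ s'ᶜ ∈ 𝔊)
    (f : Finset α) (hf : f ∈ 𝒯) (hf7 : θ f ≤ 7) (i : α) (hif : i ∉ f)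
    (t : Finset α) (ht : t ∈ 𝒯) (htf : t = insert i f) (ht57 : θ t = 5 ∨ θ t = 7)
    (a : Finset α) (ha : a ∈ 𝒯) (hia : i ∉ a) (ha89 : θ a = 8 ∨ θ a = 9)
    (a' : Finset α) (ha' : a' ∈ 𝒯) (ha'a : a' = insert i a) (ha'89 : θ a' = 8 ∨ θ a' = 9)
    (htwin : ∀ g ∈ 𝔊, i ∉ g → (f ⊆ g ↔ a ⊆ g))
    (b : Finset α) (hb : b ∈ 𝒯) (hbK : (f ∪ a ∪ {i})ᶜ ⊆ b) : f ∪ a ∈ 𝔊 := by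
  have hib : i ∈ b := by
    by_contra h
    exact rectangle'_no_inner_point 𝒯 θ hθ hcov 𝔊 hG hHL f i hif t ht htf ht57 a hia a' ha' ha'a ha'89 htwin b hb h hbK
  -- `bᶜ ⊆ f ∪ a`
  have hbc : bᶜ ⊆ f ∪ a := by
    intro x hx
    have hxb : x ∉ b := Finset.mem_compl.1 hx
    by_contra hxfa
    apply hxb
    apply hbK
    rw [Finset.mem_compl, Finset.mem_union, Finset.mem_singleton, not_or]
    exact ⟨hxfa, fun h => hxb (h ▸ hib)⟩
  by_cases hb57 : θ b = 5 ∨ θ b = 7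
  · have hgood : f ∪ bᶜ ∈ 𝔊 := hHL f hf b hb (table_hl_low_free (θ f) (hθ f hf).1 hf7 (θ b) hb57)
    exact hG _ hgood _ (Finset.union_subset subset_union_left hbc)
  · have hgood : a ∪ bᶜ ∈ 𝔊 :=
      hHL a ha b hb (table_hl_89_nonfree (θ a) ha89 (θ b) (hθ b hb).1 (hθ b hb).2 hb57)
    exact hG _ hgood _ (Finset.union_subset subset_union_right hbc)

/-- **Rectangle lemma, general lower corner** (memo §10): with `f ∈ 𝒯` of any type `≤ 7`, `t = insert i f` free,
`a, a' = insert i a ∈ 𝒯` of type `8/9`, `i ∉ f ∪ a`, the HH-good `t ∪ a'`, and the twin relation `f ⊆ g ↔ a ⊆ g` on the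
goods avoiding `i` (the rectangle circuit), the L-row of `t` is not a GF(2)-combination of H-rows. [this work] -/
theorem rectangle'_L_row_not_H_combination (𝒯 : Finset (Finset α)) (θ : Finset α → ℕ)
    (hθ : ∀ s ∈ 𝒯, 1 ≤ θ s ∧ θ s ≤ 9)
    (hcov : ∀ s ∈ 𝒯, ∀ s' ∈ 𝒯, s ≠ s' → s ∪ s' ≠ univ)
    (𝔊 : Finset (Finset α)) (hG : ∀ g ∈ 𝔊, ∀ g' : Finset α, g ⊆ g' → g' ∈ 𝔊)
    (hHL : ∀ s ∈ 𝒯, ∀ s' ∈ 𝒯, hlOK (θ s) (θ s') = true → s ∪ s'ᶜ ∈ 𝔊)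
    (hHH : ∀ q ∈ 𝒯, ∀ f' ∈ 𝒯, (θ q = 8 ∨ θ q = 9) → (θ f' = 5 ∨ θ f' = 7) → q ∪ f' ∈ 𝔊)
    (f : Finset α) (hf : f ∈ 𝒯) (hf7 : θ f ≤ 7) (i : α) (hif : i ∉ f)
    (t : Finset α) (ht : t ∈ 𝒯) (htf : t = insert i f) (ht57 : θ t = 5 ∨ θ t = 7)
    (a : Finset α) (ha : a ∈ 𝒯) (hia : i ∉ a) (ha89 : θ a = 8 ∨ θ a = 9)
    (a' : Finset α) (ha' : a' ∈ 𝒯) (ha'a : a' = insert i a) (ha'89 : θ a' = 8 ∨ θ a' = 9)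
    (htwin : ∀ g ∈ 𝔊, i ∉ g → (f ⊆ g ↔ a ⊆ g))
    (S : Finset (Finset α)) (hS : S ⊆ 𝒯) :
    ¬ (∀ h ∈ 𝔊, ((#(S.filter (fun s => s ⊆ h)) : ℕ) : ZMod 2) = if tᶜ ⊆ h then 1 else 0) := by
  by_cases hex : ∃ b ∈ 𝒯, (f ∪ a ∪ {i})ᶜ ⊆ b
  · -- interval certificate `[f ∪ a, {i}ᶜ]`
    obtain ⟨b, hb, hbK⟩ := hex
    have hB : f ∪ a ∈ 𝔊 := rectangle'_bottom_good 𝒯 θ hθ hcov 𝔊 hG hHL f hf hf7 i hif t ht htf ht57 a ha hia ha89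
      a' ha' ha'a ha'89 htwin b hb hbK
    have hBg : f ∪ a ⊆ ({i} : Finset α)ᶜ := by
      intro x hx
      rw [Finset.mem_compl, Finset.mem_singleton]
      rintro rfl
      rcases Finset.mem_union.1 hx with h | h
      · exact hif h
      · exact hia h
    have hJt : ({i} : Finset α)ᶜ \ (f ∪ a) ⊆ tᶜ := by
      intro x hx
      rcases Finset.mem_sdiff.1 hx with ⟨hxi, hxfa⟩
      rw [Finset.mem_compl, Finset.mem_singleton] at hxi
      rw [Finset.mem_compl, htf, Finset.mem_insert, not_or]
      exact ⟨hxi, fun h => hxfa (Finset.mem_union.2 (Or.inl h))⟩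
    have htg : tᶜ ⊆ ({i} : Finset α)ᶜ := by
      intro x hx
      rw [Finset.mem_compl, Finset.mem_singleton]
      intro hxi
      rw [hxi] at hx
      exact (Finset.mem_compl.1 hx) (by rw [htf]; exact Finset.mem_insert_self _ _)
    refine interval_certificate 𝔊 hG (f ∪ a) ({i} : Finset α)ᶜ hB hBg t hJt htg S ?_
    rintro q hqS ⟨hJq, hqg⟩
    have hiq : i ∉ q := fun h => by
      have := hqg h
      rw [Finset.mem_compl, Finset.mem_singleton] at this
      exact this rfl
    refine rectangle'_no_inner_point 𝒯 θ hθ hcov 𝔊 hG hHL f i hif t ht htf ht57 a hia a' ha' ha'a ha'89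
      htwin q (hS hqS) hiq ?_
    intro x hx
    apply hJq
    rw [Finset.mem_compl, Finset.mem_union, Finset.mem_union, Finset.mem_singleton, not_or, not_or] at hx
    refine Finset.mem_sdiff.2 ⟨?_, ?_⟩
    · rw [Finset.mem_compl, Finset.mem_singleton]; exact hx.2
    · intro h
      rcases Finset.mem_union.1 h with h | h
      · exact hx.1.1 h
      · exact hx.1.2 h
  · -- filter certificate with `U = t ∪ a'`
    have hU : t ∪ a' ∈ 𝔊 := by rw [Finset.union_comm]; exact hHH a' ha' t ht ha'89 ht57
    refine filter_certificate 𝔊 hG (t ∪ a') hU t subset_union_left S ?_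
    intro s hs hsub
    apply hex
    refine ⟨s, hS hs, ?_⟩
    intro x hx
    apply hsub
    rw [Finset.mem_compl, Finset.mem_union, Finset.mem_union, Finset.mem_singleton, not_or, not_or] at hx
    rw [Finset.mem_compl, Finset.mem_union, htf, ha'a, Finset.mem_insert, Finset.mem_insert, not_or, not_or, not_or]
    exact ⟨⟨hx.2, hx.1.1⟩, ⟨hx.2, hx.1.2⟩⟩

end NineType

end Summit.CriticalPhenomena.PercolationContinuityZ3.Theorems
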